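import Summits.CriticalPhenomena.Ising3DConformalLimit.Theses.AnomalousForcesInteraction
import Summits.CriticalPhenomena.Ising3DConformalLimit.Theorems.MarkovRigidityFieldRealisation
import Summits.CriticalPhenomena.Ising3DConformalLimit.Theorems.PerfectScreeningGaussianLimitIsCoulombCore
import Summits.CriticalPhenomena.Ising3DConformalLimit.Theorems.MoebiusLimitExists.Negative.ScaleRedundant
import Summits.CriticalPhenomena.Ising3DConformalLimit.Theorems.AnomalousForcesInteractionGaussianLimitIsFreeNewmanGaussianity
import Summits.CriticalPhenomena.Ising3DConformalLimit.Theorems.AnomalousForcesInteractionGaussianLimitIsFreeSphereDecouplingRigidity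
import Summits.CriticalPhenomena.Ising3DConformalLimit.Theorems.AnomalousForcesInteractionGaussianLimitIsFreeBridgeFromMarkovInheritance
import Summits.CriticalPhenomena.Ising3DConformalLimit.Theorems.AnomalousForcesInteractionGaussianLimitIsFreeReverseMartingaleTendsto
import Summits.CriticalPhenomena.Ising3DConformalLimit.Theorems.AnomalousForcesInteractionGaussianLimitIsFreeReverseMartingaleLimit
import Literature.MathematicalPhysics.QuantumLattice.GermMarkov
import HarnessLib

/-!
# Crux `GaussianLimitIsFree` (item stmt-CriticalPhenomena-2601): the crux REDUCED to one inequality —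
# `GaussianLimitIsFree ⟸ (D) ⟸ each Markov form ⟸ crux 11236` (lead c4, skeleton v10)

THEOREM-ONLY file (`--supports stmt-CriticalPhenomena-2601`, registered sub-goal
`stub_crux_of_sphereDecoupling`).  It lands, as kernel-checked implications between named statements, the
composition of the line `registered` of the crux (Newman Gaussianity ∘ Markov inheritance ∘ Gaussian–Markov
rigidity), all of whose analytic parts are tree theorems:

* `GaussianLimitIsFree_of_sphereDecoupling` — **the crux follows from the single registered stub of
  skeleton v10**, the `L²` decoupling inequality (D) across the unit sphere for the realised GAUSSIAN limit
  law: for a normalised non-degenerate translation-invariant scale-covariant pointwise limit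
  `S = (√A)ⁿ·W_Δ` of `criticalCorr 3` realised by a Gaussian probability law `μ` (all moments, exponential
  moments, moment densities `S`), for every `ε > 0`, `w` supported in `B(0,1)` and `v` supported off
  `B̄(0,1+ε)`: `|E[ω(w)ω(v)]| ≤ ‖E[ω(w) | 𝒜((∂B)^ε)]‖₂ ‖ω(v)‖₂`.  Proof = the skeleton's composition:
  normalise `S` (`normalised_*`), identify it with the generalised free field
  (`gaussian_normalised_eq_gff`, `Δ' ∈ [1/2,3/4]`, `Δ' = Δ`), realise it (`fieldRealisation_proof`, item 11245),
  Gaussianity (`stub_newmanGaussianity`, p147011), then `delta_eq_half_of_sphereDecoupling`.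
* `sphereDecoupling_of_germMarkovBalls`, `GaussianLimitIsFree_of_germMarkovBalls` — the germ form (K) at
  balls (the v3 signature `stub_markovInheritance`) implies (D), hence the crux;
* `GaussianLimitIsFree_of_markovInheritance` — **crux stmt-CriticalPhenomena-2601 ⟸ crux
  stmt-CriticalPhenomena-11236 (`MarkovRigidity.MarkovInheritance`) VERBATIM**, through the landed bridge
  `stub_markovInheritance_of_markovInheritance` (p153584);
* `condIndep_germ_ball_of_collarMarkov`, `GaussianLimitIsFree_of_collarMarkovBall` — Rozanov's collar form
  (1.27) at balls (VERBATIM `Sig.stub_collarMarkovBall` of crux 11236's line = the v9 stub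
  `stub_collarMarkovBall_limit`) implies (K) at balls by Lévy's downward theorem
  (`stub_reverseMartingale_tendsto` p162824, `stub_reverseMartingale_limit_eq_condExp` p162449), hence the crux;
* `GaussianLimitIsFree_of_shellMarkovLimit` — the THICK-SHELL Markov property of the realised Gaussian law at
  the unit ball (the conclusion of the lattice theorem `Theorems.stub_thickShellMarkov` /
  `condIndepCondExp_shell_spinFieldLaw_isingMeasure` with the lattice law replaced by the limit law) implies
  (D) (`sphereDecoupling_of_shellSplitting`), hence the crux.

So crux 2601 depends on the lattice through (D) alone, and every one of the three Markov-inheritance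
statements in circulation discharges it.  What no theorem here touches is the inheritance itself (survival
of the lattice shell-Markov property under `μ_δ ⇀ μ`; conditional independence is not weakly closed).

References: C. M. Newman, CMP 41 (1975); Yu. A. Rozanov, *Markov Random Fields* (1982), Ch. 2 §1.1–1.3,
Ch. 3 §2.3; L. D. Pitt, ARMA 43 (1971); S. Kotani, LNM 330 (1973) Thm 2; M. Aizenman, CMP 86 (1982) Prop. 12.1.
-/

noncomputable section

namespace Summit.CriticalPhenomena.Ising3DConformalLimit.Cruxes.GaussianLimitIsFree.Birth

open MeasureTheory Filter Set
open scoped BigOperators Topology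
open Literature.MathematicalPhysics.QuantumLattice
open Literature.Probability.LatticeModels
open Summit.CriticalPhenomena.Ising3DConformalLimit.Theses.AnomalousForcesInteraction (GaussianLimitIsFree)
open Summit.CriticalPhenomena.Ising3DConformalLimit.MoebiusLimitExistsOnlyInteraction (wickPower)
open Literature.Barriers.CriticalPhenomena.ScaleNotMoebius (axisUnit)

/-! ### The composition: (D) for the realised Gaussian limit law gives the crux -/

/-- Two scale exponents of a family with non-degenerate two-point function coincide (evaluate both
covariance laws on the pair `(0, e₀)` dilated by `2`). [folklore] -/
theorem delta_eq_of_isScaleCovariant' {S : CorrFamily 3} {Δ Δ' : ℝ} (hnd : IsNondegenerateTwoPoint S)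
    (h : IsScaleCovariant Δ S) (h' : IsScaleCovariant Δ' S) : Δ = Δ' := by
  have hx := zero_unitVec_mem_nonCoincident (t := (1:ℝ)) one_ne_zero
  have ha := hnd _ hx
  have e₁ := h 2 2 two_pos ![0, EuclideanSpace.single (0 : Fin 3) (1:ℝ)]
  have e₂ := h' 2 2 two_pos ![0, EuclideanSpace.single (0 : Fin 3) (1:ℝ)]
  rw [e₁] at e₂
  have h2 := mul_right_cancel₀ ha.ne' e₂
  have hlog := congrArg Real.log h2
  rw [Real.log_rpow two_pos, Real.log_rpow two_pos] at hlog
  have hl : 0 < Real.log 2 := Real.log_pos one_lt_two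
  have h3 := mul_right_cancel₀ hl.ne' hlog
  push_cast at h3
  linarith

open Summit.CriticalPhenomena.Ising3DConformalLimit.MoebiusLimitExistsNegative in
open Classical in
/-- **The crux from the decoupling inequality (D) for the realised Gaussian limit law** (hypothesis =
the statement of the single registered stub `stub_sphereDecoupling_limit` of skeleton v10, verbatim;
conclusion = `GaussianLimitIsFree` by name; real proof): normalise `S` off `NonCoincident`, identify the
normalised limit with `(√A)ⁿ · W_{Δ'}` (`gaussian_normalised_eq_gff`) and `Δ' = Δ`, realise it as a law
`μ` (`fieldRealisation_proof`), get Gaussianity from `stub_newmanGaussianity` (tree theorem), feed (D) to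
`delta_eq_half_of_sphereDecoupling`. [cite: Rozanov1982, Ch. 3 §2.3 Theorem (p. 115)] -/
theorem GaussianLimitIsFree_of_sphereDecoupling
    (hD : ∀ (ρ : ℝ → ℝ) (Δ A : ℝ) (S : Literature.Probability.LatticeModels.CorrFamily 3) (μ : MeasureTheory.Measure (Literature.MathematicalPhysics.QuantumLattice.FieldConfig (EuclideanSpace ℝ (Fin 3)))), (∀ δ ∈ Set.Ioc (0:ℝ) 1, 0 < ρ δ) → Literature.Probability.LatticeModels.HasPointwiseScalingLimit (Literature.Probability.LatticeModels.criticalCorr 3) ρ S → (∀ n z, z ∉ Literature.Probability.LatticeModels.NonCoincident 3 n → S n z = 0) → Literature.Probability.LatticeModels.IsNondegenerateTwoPoint S → Literature.Probability.LatticeModels.IsTranslationInvariant S → Literature.Probability.LatticeModels.IsScaleCovariant Δ S → 0 < A → (∀ (n : ℕ) (x : Fin n → EuclideanSpace ℝ (Fin 3)), S n x = Real.sqrt A ^ n * Summit.CriticalPhenomena.Ising3DConformalLimit.MoebiusLimitExistsOnlyInteraction.wickPower Δ n x) → MeasureTheory.IsProbabilityMeasure μ → Literature.MathematicalPhysics.QuantumLattice.HasAllMoments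 μ → (∀ f : SchwartzMap (EuclideanSpace ℝ (Fin 3)) ℝ, MeasureTheory.Integrable (fun ω : Literature.MathematicalPhysics.QuantumLattice.FieldConfig (EuclideanSpace ℝ (Fin 3)) => Real.exp (ω f)) μ) → (∀ (n : ℕ) (f : Fin n → SchwartzMap (EuclideanSpace ℝ (Fin 3)) ℝ), Literature.MathematicalPhysics.QuantumLattice.moment μ n f = ∫ x : Fin n → EuclideanSpace ℝ (Fin 3), S n x * ∏ i, f i (x i)) → Literature.MathematicalPhysics.QuantumLattice.IsGaussianField μ → ∀ (ε : ℝ), 0 < ε → ∀ (w v : SchwartzMap (EuclideanSpace ℝ (Fin 3)) ℝ), tsupport ⇑w ⊆ Metric.ball (0 : EuclideanSpace ℝ (Fin 3)) 1 → tsupport ⇑v ⊆ (Metric.closedBall (0 : EuclideanSpace ℝ (Fin 3)) (1 + ε))ᶜ → |∫ ω, ω w * ω v ∂μ| ≤ Real.sqrt (∫ ω, (MeasureTheory.condExp (Literature.MathematicalPhysics.QuantumLattice.fieldSigma (Metric.thickening ε (Metric.sphere (0 : EuclideanSpace ℝ (Fin 3)) 1))) μ (fun ω : Literature.MathematicalPhysics.QuantumLattice.FieldConfig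 (EuclideanSpace ℝ (Fin 3)) => ω w)) ω ^ 2 ∂μ) * Real.sqrt (∫ ω, (ω v) ^ 2 ∂μ)) :
    GaussianLimitIsFree := by
  intro ρ Δ S hρ hlim hnd htr hsc hU4
  -- Step 0: normalise `S` off the non-coincident configurations.
  set S' : CorrFamily 3 := fun n x => if x ∈ NonCoincident 3 n then S n x else 0 with hS'
  have hlim' : HasPointwiseScalingLimit (criticalCorr 3) ρ S' := normalised_hasLimit hlim
  have hnd' : IsNondegenerateTwoPoint S' := normalised_nondeg hnd
  have htr' : IsTranslationInvariant S' := normalised_translation htr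
  have hsc' : IsScaleCovariant Δ S' := normalised_scale hsc
  have hU4' : ¬ HasNontrivialU4 S' := fun h => hU4 (hasNontrivialU4_normalised_iff.1 h)
  have hzero' : ∀ n z, z ∉ NonCoincident 3 n → S' n z = 0 := fun n z hz => if_neg hz
  have hU' : ∀ z ∈ NonCoincident 3 4, limitConnectedFour S' z = 0 := by
    intro z hz
    by_contra h
    exact hU4' ⟨z, hz, h⟩
  -- Step 1: the Gaussian dichotomy (tree): `S' = (√A)ⁿ · W_{Δ'}`, `Δ' ∈ [1/2, 3/4]`, and `Δ' = Δ`.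
  obtain ⟨Δ', hΔ'win, hscΔ', hgff⟩ :=
    Summit.CriticalPhenomena.Ising3DConformalLimit.PerfectScreeningGaussianLimitIsCoulomb.gaussian_normalised_eq_gff
      hρ hlim' hzero' hnd' hU'
  set A : ℝ := S' 2 ![0, axisUnit] with hA
  have hApos : 0 < A := hnd' _ (zero_unitVec_mem_nonCoincident (t := (1 : ℝ)) one_ne_zero)
  have hΔ : Δ = Δ' := delta_eq_of_isScaleCovariant' hnd' hsc' hscΔ'
  have hΔ'le : Δ' ≤ 1 := hΔ'win.2.trans (by norm_num)
  -- Step 2: realise the normalised limit as a probability law `μ` on `𝒮'(ℝ³)` (item 11245, proved).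
  obtain ⟨-, μ, hμP, hμall, hμexp, hμmom, -, -, -, -, -⟩ :=
    Summit.CriticalPhenomena.Ising3DConformalLimit.MarkovRigidityFieldRealisation.fieldRealisation_proof
      ρ Δ' S' hρ hlim' hzero' hnd' htr' hscΔ'
  have hμmomW : ∀ (n : ℕ) (f : Fin n → SchwartzMap (EuclideanSpace ℝ (Fin 3)) ℝ),
      Literature.MathematicalPhysics.QuantumLattice.moment μ n f =
        ∫ x : Fin n → EuclideanSpace ℝ (Fin 3), (Real.sqrt A ^ n * wickPower Δ' n x) * ∏ i, f i (x i) := by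
    intro n f
    rw [hμmom n f]
    refine integral_congr_ae (Eventually.of_forall fun x => ?_)
    simp only [hgff n x]
  -- Step 3: Gaussianity of the realising law (Newman; tree theorem `stub_newmanGaussianity`).
  have hG : Literature.MathematicalPhysics.QuantumLattice.IsGaussianField μ :=
    stub_newmanGaussianity Δ' A μ hApos hΔ'win.1 hΔ'le hμP hμall hμexp hμmomW
  -- Step 4: the decoupling inequality for this `μ` (the stub), then rigidity.
  have hDμ := hD ρ Δ' A S' μ hρ hlim' hzero' hnd' htr' hscΔ' hApos hgff hμP hμall hμexp hμmom hG
  rw [hΔ]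
  exact delta_eq_half_of_sphereDecoupling Δ' A μ hApos hΔ'win.1 hΔ'le hμP hG hμmomW 1 one_pos
    (fun ε hε _ w v hw hv => hDμ ε hε w v hw hv)

/-- **Registered form (sub-goal `stub_crux_of_sphereDecoupling` of crux stmt-CriticalPhenomena-2601,
skeleton v10): the crux BY NAME from the statement of its single registered stub** —
`GaussianLimitIsFree_of_sphereDecoupling` verbatim. [cite: Rozanov1982, Ch. 3 §2.3 Theorem (p. 115)] -/
theorem stub_crux_of_sphereDecoupling :
    (∀ (ρ : ℝ → ℝ) (Δ A : ℝ) (S : Literature.Probability.LatticeModels.CorrFamily 3) (μ : MeasureTheory.Measure (Literature.MathematicalPhysics.QuantumLattice.FieldConfig (EuclideanSpace ℝ (Fin 3)))), (∀ δ ∈ Set.Ioc (0:ℝ) 1, 0 < ρ δ) → Literature.Probability.LatticeModels.HasPointwiseScalingLimit (Literature.Probability.LatticeModels.criticalCorr 3) ρ S → (∀ n z, z ∉ Literature.Probability.LatticeModels.NonCoincident 3 n → S n z = 0) → Literature.Probability.LatticeModels.IsNondegenerateTwoPoint S → Literature.Probability.LatticeModels.IsTranslationInvariant S → Literature.Probability.LatticeModels.IsScaleCovariant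 Δ S → 0 < A → (∀ (n : ℕ) (x : Fin n → EuclideanSpace ℝ (Fin 3)), S n x = Real.sqrt A ^ n * Summit.CriticalPhenomena.Ising3DConformalLimit.MoebiusLimitExistsOnlyInteraction.wickPower Δ n x) → MeasureTheory.IsProbabilityMeasure μ → Literature.MathematicalPhysics.QuantumLattice.HasAllMoments μ → (∀ f : SchwartzMap (EuclideanSpace ℝ (Fin 3)) ℝ, MeasureTheory.Integrable (fun ω : Literature.MathematicalPhysics.QuantumLattice.FieldConfig (EuclideanSpace ℝ (Fin 3)) => Real.exp (ω f)) μ) → (∀ (n : ℕ) (f : Fin n → SchwartzMap (EuclideanSpace ℝ (Fin 3)) ℝ), Literature.MathematicalPhysics.QuantumLattice.moment μ n f = ∫ x : Fin n → EuclideanSpace ℝ (Fin 3), S n x * ∏ i, f i (x i)) → Literature.MathematicalPhysics.QuantumLattice.IsGaussianField μ → ∀ (ε : ℝ), 0 < ε → ∀ (w v : SchwartzMap (EuclideanSpace ℝ (Fin 3)) ℝ), tsupport ⇑w ⊆ Metric.ball (0 : EuclideanSpace ℝ (Fin 3)) 1 → tsupport ⇑v ⊆ (Metric.closedBall (0 :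 EuclideanSpace ℝ (Fin 3)) (1 + ε))ᶜ → |∫ ω, ω w * ω v ∂μ| ≤ Real.sqrt (∫ ω, (MeasureTheory.condExp (Literature.MathematicalPhysics.QuantumLattice.fieldSigma (Metric.thickening ε (Metric.sphere (0 : EuclideanSpace ℝ (Fin 3)) 1))) μ (fun ω : Literature.MathematicalPhysics.QuantumLattice.FieldConfig (EuclideanSpace ℝ (Fin 3)) => ω w)) ω ^ 2 ∂μ) * Real.sqrt (∫ ω, (ω v) ^ 2 ∂μ)) → Summit.CriticalPhenomena.Ising3DConformalLimit.Theses.AnomalousForcesInteraction.GaussianLimitIsFree :=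
  GaussianLimitIsFree_of_sphereDecoupling

/-! ### The germ form (K) at balls suffices -/

/-- **(K) at balls ⇒ (D)** for the realised law: the germ-Markov property at the unit ball gives the
decoupling inequality (`sphereDecoupling_of_germSplitting`; the evaluations are in `L²` by `HasAllMoments`).
[cite: Rozanov1982, Ch. 2 §1.1 (1.1)–(1.3)] -/
theorem sphereDecoupling_of_germMarkovBalls
    (hI : ∀ (ρ : ℝ → ℝ) (Δ A : ℝ) (S : Literature.Probability.LatticeModels.CorrFamily 3) (μ : MeasureTheory.Measure (Literature.MathematicalPhysics.QuantumLattice.FieldConfig (EuclideanSpace ℝ (Fin 3)))), (∀ δ ∈ Set.Ioc (0:ℝ) 1, 0 < ρ δ) → Literature.Probability.LatticeModels.HasPointwiseScalingLimit (Literature.Probability.LatticeModels.criticalCorr 3) ρ S → (∀ n z, z ∉ Literature.Probability.LatticeModels.NonCoincident 3 n → S n z = 0) → Literature.Probability.LatticeModels.IsNondegenerateTwoPoint S → Literature.Probability.LatticeModels.IsTranslationInvariant S → Literature.Probability.LatticeModels.IsScaleCovariant Δ S → 0 < A → (∀ (n : ℕ) (x : Fin n → EuclideanSpace ℝ (Fin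 3)), S n x = Real.sqrt A ^ n * Summit.CriticalPhenomena.Ising3DConformalLimit.MoebiusLimitExistsOnlyInteraction.wickPower Δ n x) → MeasureTheory.IsProbabilityMeasure μ → Literature.MathematicalPhysics.QuantumLattice.HasAllMoments μ → (∀ f : SchwartzMap (EuclideanSpace ℝ (Fin 3)) ℝ, MeasureTheory.Integrable (fun ω : Literature.MathematicalPhysics.QuantumLattice.FieldConfig (EuclideanSpace ℝ (Fin 3)) => Real.exp (ω f)) μ) → (∀ (n : ℕ) (f : Fin n → SchwartzMap (EuclideanSpace ℝ (Fin 3)) ℝ), Literature.MathematicalPhysics.QuantumLattice.moment μ n f = ∫ x : Fin n → EuclideanSpace ℝ (Fin 3), S n x * ∏ i, f i (x i)) → Literature.MathematicalPhysics.QuantumLattice.IsGaussianField μ → ∀ (c : EuclideanSpace ℝ (Fin 3)) (r : ℝ), 0 < r → Literature.MathematicalPhysics.QuantumLattice.CondIndepCondExp (Literature.MathematicalPhysics.QuantumLattice.germSigma (frontier (Metric.ball c r))) (Literature.MathematicalPhysics.QuantumLattice.germSigma (closure (Metric.ball c r))) (Literature.MathematicalPhysics.QuantumLattice.germSigma (Metric.ball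 c r)ᶜ) μ) :
    ∀ (ρ : ℝ → ℝ) (Δ A : ℝ) (S : Literature.Probability.LatticeModels.CorrFamily 3) (μ : MeasureTheory.Measure (Literature.MathematicalPhysics.QuantumLattice.FieldConfig (EuclideanSpace ℝ (Fin 3)))), (∀ δ ∈ Set.Ioc (0:ℝ) 1, 0 < ρ δ) → Literature.Probability.LatticeModels.HasPointwiseScalingLimit (Literature.Probability.LatticeModels.criticalCorr 3) ρ S → (∀ n z, z ∉ Literature.Probability.LatticeModels.NonCoincident 3 n → S n z = 0) → Literature.Probability.LatticeModels.IsNondegenerateTwoPoint S → Literature.Probability.LatticeModels.IsTranslationInvariant S → Literature.Probability.LatticeModels.IsScaleCovariant Δ S → 0 < A → (∀ (n : ℕ) (x : Fin n → EuclideanSpace ℝ (Fin 3)), S n x = Real.sqrt A ^ n * Summit.CriticalPhenomena.Ising3DConformalLimit.MoebiusLimitExistsOnlyInteraction.wickPower Δ n x) → MeasureTheory.IsProbabilityMeasure μ → Literature.MathematicalPhysics.QuantumLattice.HasAllMoments μ → (∀ f : SchwartzMap (EuclideanSpace ℝ (Fin 3)) ℝ, MeasureTheory.Integrable (fun ω :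 Literature.MathematicalPhysics.QuantumLattice.FieldConfig (EuclideanSpace ℝ (Fin 3)) => Real.exp (ω f)) μ) → (∀ (n : ℕ) (f : Fin n → SchwartzMap (EuclideanSpace ℝ (Fin 3)) ℝ), Literature.MathematicalPhysics.QuantumLattice.moment μ n f = ∫ x : Fin n → EuclideanSpace ℝ (Fin 3), S n x * ∏ i, f i (x i)) → Literature.MathematicalPhysics.QuantumLattice.IsGaussianField μ → ∀ (ε : ℝ), 0 < ε → ∀ (w v : SchwartzMap (EuclideanSpace ℝ (Fin 3)) ℝ), tsupport ⇑w ⊆ Metric.ball (0 : EuclideanSpace ℝ (Fin 3)) 1 → tsupport ⇑v ⊆ (Metric.closedBall (0 : EuclideanSpace ℝ (Fin 3)) (1 + ε))ᶜ → |∫ ω, ω w * ω v ∂μ| ≤ Real.sqrt (∫ ω, (MeasureTheory.condExp (Literature.MathematicalPhysics.QuantumLattice.fieldSigma (Metric.thickening ε (Metric.sphere (0 : EuclideanSpace ℝ (Fin 3)) 1))) μ (fun ω : Literature.MathematicalPhysics.QuantumLattice.FieldConfig (EuclideanSpace ℝ (Fin 3)) => ω w)) ω ^ 2 ∂μ) *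 Real.sqrt (∫ ω, (ω v) ^ 2 ∂μ) := by
  intro ρ Δ A S μ hρ hlim hzero hnd htr hsc hA hS hμP hall hexp hmom hG ε hε w v hw hv
  haveI := hμP
  have hK := hI ρ Δ A S μ hρ hlim hzero hnd htr hsc hA hS hμP hall hexp hmom hG 0 1 one_pos
  have hv' : tsupport ⇑v ⊆ (Metric.closedBall (0 : EuclideanSpace ℝ (Fin 3)) 1)ᶜ :=
    hv.trans (Set.compl_subset_compl.2 (Metric.closedBall_subset_closedBall (by linarith)))
  exact sphereDecoupling_of_germSplitting hK hε hw hv' (hall 2 w) (hall 2 v)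

/-- **The crux from the germ-Markov property (K) at balls of the realised Gaussian limit law** (the v3–v7
registered signature `stub_markovInheritance`). [cite: Rozanov1982, Ch. 3 §2.3 Theorem (p. 115)] -/
theorem GaussianLimitIsFree_of_germMarkovBalls
    (hI : ∀ (ρ : ℝ → ℝ) (Δ A : ℝ) (S : Literature.Probability.LatticeModels.CorrFamily 3) (μ : MeasureTheory.Measure (Literature.MathematicalPhysics.QuantumLattice.FieldConfig (EuclideanSpace ℝ (Fin 3)))), (∀ δ ∈ Set.Ioc (0:ℝ) 1, 0 < ρ δ) → Literature.Probability.LatticeModels.HasPointwiseScalingLimit (Literature.Probability.LatticeModels.criticalCorr 3) ρ S → (∀ n z, z ∉ Literature.Probability.LatticeModels.NonCoincident 3 n → S n z = 0) → Literature.Probability.LatticeModels.IsNondegenerateTwoPoint S → Literature.Probability.LatticeModels.IsTranslationInvariant S → Literature.Probability.LatticeModels.IsScaleCovariant Δ S → 0 < A → (∀ (n : ℕ) (x : Fin n → EuclideanSpace ℝ (Fin 3)), S n x = Real.sqrt A ^ n * Summit.CriticalPhenomena.Ising3DConformalLimit.MoebiusLimitExistsOnlyInteraction.wickPower Δ n x)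 → MeasureTheory.IsProbabilityMeasure μ → Literature.MathematicalPhysics.QuantumLattice.HasAllMoments μ → (∀ f : SchwartzMap (EuclideanSpace ℝ (Fin 3)) ℝ, MeasureTheory.Integrable (fun ω : Literature.MathematicalPhysics.QuantumLattice.FieldConfig (EuclideanSpace ℝ (Fin 3)) => Real.exp (ω f)) μ) → (∀ (n : ℕ) (f : Fin n → SchwartzMap (EuclideanSpace ℝ (Fin 3)) ℝ), Literature.MathematicalPhysics.QuantumLattice.moment μ n f = ∫ x : Fin n → EuclideanSpace ℝ (Fin 3), S n x * ∏ i, f i (x i)) → Literature.MathematicalPhysics.QuantumLattice.IsGaussianField μ → ∀ (c : EuclideanSpace ℝ (Fin 3)) (r : ℝ), 0 < r → Literature.MathematicalPhysics.QuantumLattice.CondIndepCondExp (Literature.MathematicalPhysics.QuantumLattice.germSigma (frontier (Metric.ball c r))) (Literature.MathematicalPhysics.QuantumLattice.germSigma (closure (Metric.ball c r))) (Literature.MathematicalPhysics.QuantumLattice.germSigma (Metric.ball c r)ᶜ) μ) :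
    GaussianLimitIsFree :=
  GaussianLimitIsFree_of_sphereDecoupling (sphereDecoupling_of_germMarkovBalls hI)

/-- **Crux stmt-CriticalPhenomena-2601 ⟸ crux stmt-CriticalPhenomena-11236, verbatim**: McKean's germ-Markov
inheritance `MarkovRigidity.MarkovInheritance` (item 11236, by name) implies `GaussianLimitIsFree` (item
2601, by name), through the landed bridge `stub_markovInheritance_of_markovInheritance` (p153584) and
`GaussianLimitIsFree_of_germMarkovBalls`. [cite: Rozanov1982, Ch. 2 §1.3 (1.28)] -/
theorem GaussianLimitIsFree_of_markovInheritance
    (hMI : Summit.CriticalPhenomena.Ising3DConformalLimit.Theses.MarkovRigidity.MarkovInheritance) :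
    GaussianLimitIsFree :=
  GaussianLimitIsFree_of_germMarkovBalls (stub_markovInheritance_of_markovInheritance hMI)

/-! ### Rozanov's collar form (1.27) at balls suffices (Lévy's downward theorem) -/

/-- The germ σ-algebra along the sequence `εₙ = 1/(n+1)`: `𝒜₊(B) = ⨅ₙ 𝒜(B_{1/(n+1)})` (cofinality).
[folklore] -/
theorem germSigma_eq_iInf_nat' (B : Set (EuclideanSpace ℝ (Fin 3))) :
    germSigma B = ⨅ n : ℕ, fieldSigma (Metric.thickening (1 / ((n : ℝ) + 1)) B) := by
  refine le_antisymm (le_iInf fun n => germSigma_le_fieldSigma_thickening B (by positivity)) ?_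
  refine le_iInf fun ε => ?_
  obtain ⟨n, hn⟩ := exists_nat_one_div_lt ε.2
  exact iInf_le_of_le n (fieldSigma_mono (Metric.thickening_mono hn.le B))

/-- **Collar form (1.27) at a ball ⇒ germ form (1.28) at that ball** (Rozanov 1982, Ch. 2 §1.3): if for a
probability law `μ` on `𝒮'(ℝ³)` and the open ball `U = B(c, r)` every bounded `F` measurable for the inner
germ `⨅_{ε>0} 𝒜(U_ε)` satisfies `μ[F | 𝒜((Uᶜ)_ε)] = μ[F | 𝒜((∂U)_ε)]` a.e. for EVERY `ε > 0`, then `𝒜₊(∂U)`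
splits `𝒜₊(Ū)` and `𝒜₊(Uᶜ)`: along `εₙ = 1/(n+1)` the two sides are reverse martingales with a.e. limits
`μ[F | 𝒜₊(Uᶜ)]`, `μ[F | 𝒜₊(∂U)]` (Lévy's downward theorem, `stub_reverseMartingale_tendsto` /
`stub_reverseMartingale_limit_eq_condExp`), so the one-sided germ identity holds for indicators and
`condIndepCondExp_of_condExp_indicator_eq` gives the splitting. [cite: Rozanov1982, Ch. 2 §1.3 (1.26)–(1.28)] -/
theorem condIndep_germ_ball_of_collarMarkov
    (μ : Measure (FieldConfig (EuclideanSpace ℝ (Fin 3)))) [IsProbabilityMeasure μ]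
    (c : EuclideanSpace ℝ (Fin 3)) (r : ℝ)
    (h2a : ∀ (F : FieldConfig (EuclideanSpace ℝ (Fin 3)) → ℝ),
      Measurable[⨅ (ε : ℝ) (_ : 0 < ε), fieldSigma (Metric.thickening ε (Metric.ball c r))] F →
      (∃ C : ℝ, ∀ ω, |F ω| ≤ C) → ∀ ε : ℝ, 0 < ε →
        μ[F | fieldSigma (Metric.thickening ε (Metric.ball c r)ᶜ)] =ᵐ[μ]
          μ[F | fieldSigma (Metric.thickening ε (frontier (Metric.ball c r)))]) :
    CondIndepCondExp (germSigma (frontier (Metric.ball c r))) (germSigma (closure (Metric.ball c r)))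
      (germSigma (Metric.ball c r)ᶜ) μ := by
  set U : Set (EuclideanSpace ℝ (Fin 3)) := Metric.ball c r with hU
  have hgerm : ∀ B : Set (EuclideanSpace ℝ (Fin 3)),
      (⨅ (ε : ℝ) (_ : 0 < ε), fieldSigma (E := EuclideanSpace ℝ (Fin 3)) (Metric.thickening ε B)) = germSigma B :=
    fun B => germ_eq_germSigma (E := EuclideanSpace ℝ (Fin 3)) B
  have hin : (⨅ (ε : ℝ) (_ : 0 < ε), fieldSigma (E := EuclideanSpace ℝ (Fin 3)) (Metric.thickening ε U)) =
      germSigma (closure U) := by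
    rw [hgerm U, ← germSigma_closure]
  have hfr_sub : frontier U ⊆ Uᶜ := by
    rw [Metric.isOpen_ball.frontier_eq]
    exact fun x hx => hx.2
  refine condIndepCondExp_of_condExp_indicator_eq (germSigma_le _) (germSigma_le _) (germSigma_le _)
    (germSigma_mono hfr_sub) fun s hs => ?_
  -- the bounded test variable
  set F : FieldConfig (EuclideanSpace ℝ (Fin 3)) → ℝ := s.indicator fun _ => (1 : ℝ) with hF
  have hmeasF : Measurable[⨅ (ε : ℝ) (_ : 0 < ε), fieldSigma (Metric.thickening ε U)] F := by
    rw [hin]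
    exact (measurable_const (a := (1 : ℝ))).indicator hs
  have hF1 : ∀ ω, |F ω| ≤ 1 := fun ω => by
    by_cases hω : ω ∈ s <;> simp [hF, hω]
  have hbdd : ∃ C : ℝ, ∀ ω, |F ω| ≤ C := ⟨1, hF1⟩
  have hFm : Measurable F := (measurable_const (a := (1 : ℝ))).indicator (germSigma_le _ s hs)
  -- the two antitone sequences of σ-algebras and their infima
  set mOut : ℕ → MeasurableSpace (FieldConfig (EuclideanSpace ℝ (Fin 3))) :=
    fun n => fieldSigma (Metric.thickening (1 / ((n : ℝ) + 1)) Uᶜ) with hmOut_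
  set mCol : ℕ → MeasurableSpace (FieldConfig (EuclideanSpace ℝ (Fin 3))) :=
    fun n => fieldSigma (Metric.thickening (1 / ((n : ℝ) + 1)) (frontier U)) with hmCol_
  have hanti : ∀ (B : Set (EuclideanSpace ℝ (Fin 3))),
      Antitone (fun n : ℕ => fieldSigma (E := EuclideanSpace ℝ (Fin 3)) (Metric.thickening (1 / ((n : ℝ) + 1)) B)) := by
    intro B m n hmn
    refine fieldSigma_mono (Metric.thickening_mono ?_ B)
    exact one_div_le_one_div_of_le (by positivity) (by exact_mod_cast Nat.add_le_add_right hmn 1)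
  have hmOut_anti : Antitone mOut := hanti Uᶜ
  have hmCol_anti : Antitone mCol := hanti (frontier U)
  have hmOut_le : ∀ n, mOut n ≤ FieldConfig.instMeasurableSpace := fun n => fieldSigma_le _
  have hmCol_le : ∀ n, mCol n ≤ FieldConfig.instMeasurableSpace := fun n => fieldSigma_le _
  have hiInfOut : (⨅ n, mOut n) = germSigma Uᶜ := (germSigma_eq_iInf_nat' _).symm
  have hiInfCol : (⨅ n, mCol n) = germSigma (frontier U) := (germSigma_eq_iInf_nat' _).symm
  -- termwise a.e. equality (the collar identity at ε = 1/(n+1))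
  have hn : ∀ n : ℕ, μ[F | mOut n] =ᵐ[μ] μ[F | mCol n] := fun n =>
    h2a F hmeasF hbdd (1 / ((n : ℝ) + 1)) (by positivity)
  -- Lévy's downward theorem on both sides
  obtain ⟨G₁, hG₁m, hG₁b, hG₁t⟩ := stub_reverseMartingale_tendsto μ mOut hmOut_anti hmOut_le F 1 hFm hF1
  obtain ⟨G₂, hG₂m, hG₂b, hG₂t⟩ := stub_reverseMartingale_tendsto μ mCol hmCol_anti hmCol_le F 1 hFm hF1
  have hG₁ := stub_reverseMartingale_limit_eq_condExp μ mOut hmOut_anti hmOut_le F G₁ 1 hFm hF1 hG₁m hG₁b hG₁t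
  have hG₂ := stub_reverseMartingale_limit_eq_condExp μ mCol hmCol_anti hmCol_le F G₂ 1 hFm hF1 hG₂m hG₂b hG₂t
  have hall_n : ∀ᵐ ω ∂μ, ∀ n, (μ[F | mOut n]) ω = (μ[F | mCol n]) ω := ae_all_iff.2 hn
  have hG12 : G₁ =ᵐ[μ] G₂ := by
    filter_upwards [hall_n, hG₁t, hG₂t] with ω hωn h1 h2
    have hfun : (fun n => (μ[F | mOut n]) ω) = fun n => (μ[F | mCol n]) ω := funext hωn
    rw [hfun] at h1
    exact tendsto_nhds_unique h1 h2
  have hfin : μ[F | ⨅ n, mOut n] =ᵐ[μ] μ[F | ⨅ n, mCol n] := hG₁.symm.trans (hG12.trans hG₂)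
  rw [hiInfOut, hiInfCol] at hfin
  exact hfin

/-- **The crux from Rozanov's collar Markov property at balls** (hypothesis = VERBATIM the statement
`Sig.stub_collarMarkovBall` of crux stmt-CriticalPhenomena-11236's registered line = the v8/v9 stub
`stub_collarMarkovBall_limit` of this crux's line; no Gaussianity assumed there): collar ⇒ germ at every
ball (`condIndep_germ_ball_of_collarMarkov`), then `GaussianLimitIsFree_of_germMarkovBalls`.
[cite: Rozanov1982, Ch. 2 §1.3 (1.26)–(1.28)] -/
theorem GaussianLimitIsFree_of_collarMarkovBall
    (h2a : ∀ (ρ : ℝ → ℝ) (Δ : ℝ) (S : Literature.Probability.LatticeModels.CorrFamily 3) (μ : MeasureTheory.Measure (Literature.MathematicalPhysics.QuantumLattice.FieldConfig (EuclideanSpace ℝ (Fin 3)))),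
    (∀ δ ∈ Set.Ioc (0:ℝ) 1, 0 < ρ δ) →
    Literature.Probability.LatticeModels.HasPointwiseScalingLimit (Literature.Probability.LatticeModels.criticalCorr 3) ρ S →
    (∀ n z, z ∉ Literature.Probability.LatticeModels.NonCoincident 3 n → S n z = 0) →
    Literature.Probability.LatticeModels.IsNondegenerateTwoPoint S →
    Literature.Probability.LatticeModels.IsTranslationInvariant S →
    Literature.Probability.LatticeModels.IsScaleCovariant Δ S →
    MeasureTheory.IsProbabilityMeasure μ →
    Literature.MathematicalPhysics.QuantumLattice.HasAllMoments μ →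
    (∀ f : SchwartzMap (EuclideanSpace ℝ (Fin 3)) ℝ, MeasureTheory.Integrable (fun ω : (Literature.MathematicalPhysics.QuantumLattice.FieldConfig (EuclideanSpace ℝ (Fin 3))) => Real.exp (ω f)) μ) →
    (∀ (n : ℕ) (f : Fin n → SchwartzMap (EuclideanSpace ℝ (Fin 3)) ℝ), Literature.MathematicalPhysics.QuantumLattice.moment μ n f = ∫ x : Fin n → (EuclideanSpace ℝ (Fin 3)), S n x * ∏ i, f i (x i)) →
    ∀ (sig : Set (EuclideanSpace ℝ (Fin 3)) → MeasurableSpace (Literature.MathematicalPhysics.QuantumLattice.FieldConfig (EuclideanSpace ℝ (Fin 3)))),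
      (sig = fun A => ⨆ (f : SchwartzMap (EuclideanSpace ℝ (Fin 3)) ℝ) (_ : tsupport ⇑f ⊆ A), MeasurableSpace.comap (fun ω : (Literature.MathematicalPhysics.QuantumLattice.FieldConfig (EuclideanSpace ℝ (Fin 3))) => ω f) (borel ℝ)) →
    ∀ (U : Set (EuclideanSpace ℝ (Fin 3))), (∃ (c : (EuclideanSpace ℝ (Fin 3))) (r : ℝ), U = Metric.ball c r) →
    ∀ (F : (Literature.MathematicalPhysics.QuantumLattice.FieldConfig (EuclideanSpace ℝ (Fin 3))) → ℝ), @Measurable _ _ (⨅ (ε : ℝ) (_ : 0 < ε), sig (Metric.thickening ε U)) _ F →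
      (∃ C : ℝ, ∀ ω, |F ω| ≤ C) →
    ∀ (ε : ℝ), 0 < ε →
      MeasureTheory.condExp (sig (Metric.thickening ε Uᶜ)) μ F =ᵐ[μ] MeasureTheory.condExp (sig (Metric.thickening ε (frontier U))) μ F) :
    GaussianLimitIsFree := by
  refine GaussianLimitIsFree_of_germMarkovBalls ?_
  intro ρ Δ A S μ hρ hlim hzero hnd htr hsc _hA _hS hμP hall hexp hmom _hG c r _hr
  haveI := hμP
  have hsig : (fun A : Set (EuclideanSpace ℝ (Fin 3)) => fieldSigma (E := EuclideanSpace ℝ (Fin 3)) A) =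
      fun A => ⨆ (f : SchwartzMap (EuclideanSpace ℝ (Fin 3)) ℝ) (_ : tsupport ⇑f ⊆ A),
        MeasurableSpace.comap (fun ω : FieldConfig (EuclideanSpace ℝ (Fin 3)) => ω f) (borel ℝ) :=
    funext fun A => (sig_eq_fieldSigma A).symm
  have hball : ∃ (c' : EuclideanSpace ℝ (Fin 3)) (r' : ℝ), Metric.ball c r = Metric.ball c' r' := ⟨c, r, rfl⟩
  have h := h2a ρ Δ S μ hρ hlim hzero hnd htr hsc hμP hall hexp hmom (fun A => fieldSigma A) hsig
    (Metric.ball c r) hball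
  exact condIndep_germ_ball_of_collarMarkov μ c r fun F hF hbdd ε hε => h F hF hbdd ε hε

/-! ### The thick-shell form at the unit ball suffices -/

/-- **The crux from the thick-shell Markov property of the realised Gaussian limit law at the unit ball**
(the conclusion of the lattice theorem `Theorems.stub_thickShellMarkov` /
`condIndepCondExp_shell_spinFieldLaw_isingMeasure`, at `c = 0`, `r = 1`, with the finite-volume lattice law
replaced by the limit law): thick shell ⇒ (D) (`sphereDecoupling_of_shellSplitting`), then
`GaussianLimitIsFree_of_sphereDecoupling`. [cite: Rozanov1982, Ch. 2 §1.1 (1.1)–(1.4)] -/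
theorem GaussianLimitIsFree_of_shellMarkovLimit
    (hS : ∀ (ρ : ℝ → ℝ) (Δ A : ℝ) (S : Literature.Probability.LatticeModels.CorrFamily 3) (μ : MeasureTheory.Measure (Literature.MathematicalPhysics.QuantumLattice.FieldConfig (EuclideanSpace ℝ (Fin 3)))), (∀ δ ∈ Set.Ioc (0:ℝ) 1, 0 < ρ δ) → Literature.Probability.LatticeModels.HasPointwiseScalingLimit (Literature.Probability.LatticeModels.criticalCorr 3) ρ S → (∀ n z, z ∉ Literature.Probability.LatticeModels.NonCoincident 3 n → S n z = 0) → Literature.Probability.LatticeModels.IsNondegenerateTwoPoint S → Literature.Probability.LatticeModels.IsTranslationInvariant S → Literature.Probability.LatticeModels.IsScaleCovariant Δ S → 0 < A → (∀ (n : ℕ) (x : Fin n → EuclideanSpace ℝ (Fin 3)), S n x = Real.sqrt A ^ n * Summit.CriticalPhenomena.Ising3DConformalLimit.MoebiusLimitExistsOnlyInteraction.wickPower Δ n x) → MeasureTheory.IsProbabilityMeasure μ → Literature.MathematicalPhysics.QuantumLattice.HasAllMoments μ → (∀ f : SchwartzMap (EuclideanSpace ℝ (Fin 3)) ℝ, MeasureTheory.Integrable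 (fun ω : Literature.MathematicalPhysics.QuantumLattice.FieldConfig (EuclideanSpace ℝ (Fin 3)) => Real.exp (ω f)) μ) → (∀ (n : ℕ) (f : Fin n → SchwartzMap (EuclideanSpace ℝ (Fin 3)) ℝ), Literature.MathematicalPhysics.QuantumLattice.moment μ n f = ∫ x : Fin n → EuclideanSpace ℝ (Fin 3), S n x * ∏ i, f i (x i)) → Literature.MathematicalPhysics.QuantumLattice.IsGaussianField μ → ∀ (ε : ℝ), 0 < ε → Literature.MathematicalPhysics.QuantumLattice.CondIndepCondExp (Literature.MathematicalPhysics.QuantumLattice.extEvents (Metric.ball (0 : EuclideanSpace ℝ (Fin 3)) (1 + ε) \ Metric.closedBall (0 : EuclideanSpace ℝ (Fin 3)) 1)) (Literature.MathematicalPhysics.QuantumLattice.extEvents (Metric.ball (0 : EuclideanSpace ℝ (Fin 3)) 1)) (Literature.MathematicalPhysics.QuantumLattice.extEvents (Metric.closedBall (0 : EuclideanSpace ℝ (Fin 3)) (1 + ε / 2))ᶜ) μ) :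
    GaussianLimitIsFree := by
  refine GaussianLimitIsFree_of_sphereDecoupling ?_
  intro ρ Δ A S μ hρ hlim hzero hnd htr hsc hA hSgff hμP hall hexp hmom hG ε hε w v hw hv
  haveI := hμP
  exact sphereDecoupling_of_shellSplitting hε.le
    (hS ρ Δ A S μ hρ hlim hzero hnd htr hsc hA hSgff hμP hall hexp hmom hG ε hε) hw hv (hall 2 w) (hall 2 v)

end Summit.CriticalPhenomena.Ising3DConformalLimit.Cruxes.GaussianLimitIsFree.Birth

end
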